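import Summits.CriticalPhenomena.PercolationContinuityZ3.Theorems.PercNearOneGluingNoHeavyQuantFarSunWitnessAvg
import Summits.CriticalPhenomena.PercolationContinuityZ3.Theorems.PercNearOneGluingNoHeavyQuantFarSunCondition
import Mathlib.Algebra.BigOperators.Group.Finset.Powerset
import Mathlib.Tactic.FieldSimp
import Mathlib.Tactic.Ring
import Mathlib.Tactic.Linarith
import Mathlib.Tactic.Positivity
import HarnessLib

/-!
# FAR beyond trees: witnesses of a PREFIX are witnesses — the universal-witness weight of `K` hairs dominates that of the first `K₀`,
# and the least-reliable-witness weight dominates the averaged one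

builds on p205010 (kernel theorem, internal audit signed; external expert review pending)

Support file (`--supports stmt-CriticalPhenomena-4575`), seat `prim-cert-1` (gen 39); memo `prim-cert-1/FROM-prim-cert-1-g39-VERTEX-GAME.md` §0(iii), §4 (L4').
This replaces insertion monotonicity: to certify `SunFAR K 2` on the box `[η,1]^K` for EVERY `K ≥ K₀` it suffices to certify the averaged weight on
`[η,1]^{K₀}` (a finite game certificate), because

* `HairyCycle.wit_inter_range_subset` — a witness of `Q ∩ range K₀` is a witness of `Q`;
* `HairyCycle.sum_hairW_inter_eq` — marginalisation: `Σ_{Q ⊆ range K, Q ∩ range K₀ = Q'} hairW K h Q = hairW K₀ h Q'` (`K₀ ≤ K`);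
* **`HairyCycle.witG_prefix_ge`** — with the selector `prefixSel K₀ z₀` (use `z₀` on `Q ∩ range K₀` when it has a witness, else any witness of `Q`):
  `witG K h j (prefixSel K₀ z₀) ≥ witG K₀ h j z₀` (`h ∈ [0,1]` on `range K`), and `prefixSel` is a valid selection;
* `HairyCycle.minSel` (a least-reliable witness) and **`HairyCycle.witG_minSel_ge_witGavg`** — `witG K h j (minSel h j) ≥ witGavg K h j` (`0 < h ≤ 1`):
  the maximum of `1/h` over the witnesses dominates its average.
Hence `1 ≤ witGavg K₀ (h|K₀) 2 ⇒ 1 ≤ witG K h 2 (prefixSel K₀ (minSel h 2))`, the hypothesis of `HairyCycle.hairCert_of_witness` (`…QuantFarSunWitnessCert`).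
Elementary [this work]; no sorries; standard axioms.
-/

noncomputable section

namespace Summit.CriticalPhenomena.PercolationContinuityZ3.Theorems.HairyCycle

open Finset
open scoped Classical

variable {K : ℕ}

/-! ## Witnesses of a sub-pattern -/

/-- A witness of a sub-pattern `Q' ⊆ Q` is a witness of `Q`. [this work] -/
theorem wit_mono {j : ℕ} {Q' Q : Finset ℕ} (hsub : Q' ⊆ Q) : wit j Q' ⊆ wit j Q := by
  intro d hd
  obtain ⟨hdQ', hb, ha⟩ := Finset.mem_filter.1 hd
  refine Finset.mem_filter.2 ⟨hsub hdQ', le_trans hb (Finset.card_le_card ?_), le_trans ha (Finset.card_le_card ?_)⟩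
  · exact Finset.monotone_filter_left _ hsub
  · exact Finset.monotone_filter_left _ hsub

/-- In particular for the prefix part `Q ∩ range K₀`. [this work] -/
theorem wit_inter_range_subset (j K₀ : ℕ) (Q : Finset ℕ) : wit j (Q ∩ range K₀) ⊆ wit j Q :=
  wit_mono Finset.inter_subset_left

/-! ## Marginalising the hair law over a tail -/

/-- **Marginalisation**: for `K₀ ≤ K` and `Q' ⊆ range K₀`,
`Σ_{Q ⊆ range K, Q ∩ range K₀ = Q'} hairW K h Q = hairW K₀ h Q'`. [this work] -/
theorem sum_hairW_inter_eq (h : ℕ → ℝ) {K₀ : ℕ} {Q' : Finset ℕ} (hQ' : Q' ⊆ range K₀) :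
    ∀ K : ℕ, K₀ ≤ K → ∑ Q ∈ ((range K).powerset).filter (fun Q => Q ∩ range K₀ = Q'), hairW K h Q = hairW K₀ h Q' := by
  intro K hK
  induction K, hK using Nat.le_induction with
  | base =>
    have hfil : ((range K₀).powerset).filter (fun Q => Q ∩ range K₀ = Q') = {Q'} := by
      ext Q
      rw [Finset.mem_filter, Finset.mem_powerset, Finset.mem_singleton]
      constructor
      · rintro ⟨hQ, hQQ'⟩; rw [← hQQ', Finset.inter_eq_left.2 hQ]
      · rintro rfl; exact ⟨hQ', Finset.inter_eq_left.2 hQ'⟩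
    rw [hfil, Finset.sum_singleton]
  | succ K hK ih =>
    -- split the patterns of `range (K+1)` at the new hair `K`
    have hKn : K ∉ range K := Finset.notMem_range_self
    have hKK₀ : K ∉ range K₀ := fun hm => absurd (Finset.mem_range.1 hm) (not_lt.2 hK)
    have hpow : (range (K + 1)).powerset = (range K).powerset ∪ ((range K).powerset).image (insert K) := by
      rw [Finset.range_add_one, Finset.powerset_insert]
    have hdisj : Disjoint ((range K).powerset) (((range K).powerset).image (insert K)) := by
      rw [Finset.disjoint_left]
      intro Q hQ hQ'
      rw [Finset.mem_image] at hQ'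
      obtain ⟨R, _, hR⟩ := hQ'
      have : K ∈ Q := hR ▸ Finset.mem_insert_self K R
      exact hKn (Finset.mem_powerset.1 hQ this)
    rw [hpow, Finset.filter_union, Finset.sum_union (Finset.disjoint_filter_filter hdisj)]
    -- closed at `K`: factor `1 − h K`
    have h1 : ∑ Q ∈ ((range K).powerset).filter (fun Q => Q ∩ range K₀ = Q'), hairW (K + 1) h Q =
        (1 - h K) * ∑ Q ∈ ((range K).powerset).filter (fun Q => Q ∩ range K₀ = Q'), hairW K h Q := by
      rw [Finset.mul_sum]
      refine Finset.sum_congr rfl fun Q hQ => ?_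
      have hKQ : K ∉ Q := fun hm => hKn (Finset.mem_powerset.1 (Finset.mem_filter.1 hQ).1 hm)
      unfold hairW
      rw [Finset.prod_range_succ, if_neg hKQ, mul_comm]
    -- open at `K`: factor `h K`
    have h2 : ∑ Q ∈ (((range K).powerset).image (insert K)).filter (fun Q => Q ∩ range K₀ = Q'), hairW (K + 1) h Q =
        h K * ∑ Q ∈ ((range K).powerset).filter (fun Q => Q ∩ range K₀ = Q'), hairW K h Q := by
      rw [Finset.filter_image, Finset.sum_image, Finset.mul_sum]
      · -- the filters agree (`K ∉ range K₀`) and the weights factor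
        have hfil : ((range K).powerset).filter (fun R => insert K R ∩ range K₀ = Q') =
            ((range K).powerset).filter (fun R => R ∩ range K₀ = Q') := by
          refine Finset.filter_congr fun R _ => ?_
          rw [Finset.insert_inter_of_notMem hKK₀]
        rw [hfil]
        refine Finset.sum_congr rfl fun Q hQ => ?_
        have hQK : Q ⊆ range K := Finset.mem_powerset.1 (Finset.mem_filter.1 hQ).1
        have hKQ : K ∉ Q := fun hm => hKn (hQK hm)
        unfold hairW
        rw [Finset.prod_range_succ, if_pos (Finset.mem_insert_self K Q), mul_comm]
        congr 1
        refine Finset.prod_congr rfl fun k hk => ?_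
        have hkK : k ≠ K := fun e => hKn (e ▸ hk)
        simp only [Finset.mem_insert, hkK, false_or]
      · -- `insert K` is injective on patterns avoiding `K`
        intro R hR R' hR' hRR'
        have hKR : K ∉ R := fun hm => hKn (Finset.mem_powerset.1 (Finset.mem_filter.1 hR).1 hm)
        have hKR' : K ∉ R' := fun hm => hKn (Finset.mem_powerset.1 (Finset.mem_filter.1 hR').1 hm)
        rw [← Finset.erase_insert hKR, hRR', Finset.erase_insert hKR']
    rw [h1, h2, ih]
    ring

/-! ## The prefix selector -/

/-- Use `z₀` on the prefix part when it has a witness; otherwise any witness of `Q` (junk `0` if none). [this work] -/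
def prefixSel (K₀ j : ℕ) (z₀ : Finset ℕ → ℕ) (Q : Finset ℕ) : ℕ :=
  if (wit j (Q ∩ range K₀)).Nonempty then z₀ (Q ∩ range K₀)
  else if hQ : (wit j Q).Nonempty then (wit j Q).min' hQ else 0

/-- The prefix selector is a valid selection of witnesses when `z₀` is (on patterns `⊆ range K₀`). [this work] -/
theorem prefixSel_mem_wit {K₀ j : ℕ} {z₀ : Finset ℕ → ℕ} (hz₀ : ∀ Q', Q' ⊆ range K₀ → (wit j Q').Nonempty → z₀ Q' ∈ wit j Q')
    (Q : Finset ℕ) (hQ : (wit j Q).Nonempty) : prefixSel K₀ j z₀ Q ∈ wit j Q := by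
  unfold prefixSel
  by_cases hne : (wit j (Q ∩ range K₀)).Nonempty
  · rw [if_pos hne]
    exact wit_inter_range_subset j K₀ Q (hz₀ _ Finset.inter_subset_right hne)
  · rw [if_neg hne, dif_pos hQ]
    exact Finset.min'_mem _ hQ

/-- **The universal-witness weight of `K` hairs dominates that of the first `K₀`** (prefix selector, `h ∈ [0,1]` on `range K`, `K₀ ≤ K`; no validity of `z₀` needed). [this work] -/
theorem witG_prefix_ge {h : ℕ → ℝ} (hh : ∀ k, k < K → 0 ≤ h k ∧ h k ≤ 1) {K₀ j : ℕ} (hK₀ : K₀ ≤ K) (z₀ : Finset ℕ → ℕ) :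
    witG K₀ h j z₀ ≤ witG K h j (prefixSel K₀ j z₀) := by
  unfold witG
  have hsub : range K₀ ⊆ range K := Finset.range_subset_range.2 hK₀
  refine le_trans ?_ (Finset.sum_le_sum_of_subset_of_nonneg hsub fun k hk _ =>
    div_nonneg (witMass_nonneg hh j _ k) (hh k (Finset.mem_range.1 hk)).1)
  refine Finset.sum_le_sum fun k hk => div_le_div_of_nonneg_right ?_ (hh k (Finset.mem_range.1 (hsub hk))).1
  -- `witMass K₀ z₀ k ≤ witMass K (prefixSel) k`: group the big patterns by their prefix part
  unfold witMass
  have hgroup : ∑ Q ∈ (range K).powerset, (if (wit j Q).Nonempty ∧ prefixSel K₀ j z₀ Q = k then hairW K h Q else 0) =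
      ∑ Q' ∈ (range K₀).powerset, ∑ Q ∈ ((range K).powerset).filter (fun Q => Q ∩ range K₀ = Q'),
        (if (wit j Q).Nonempty ∧ prefixSel K₀ j z₀ Q = k then hairW K h Q else 0) := by
    rw [← Finset.sum_biUnion]
    · congr 1
      ext Q
      rw [Finset.mem_biUnion]
      constructor
      · intro hQ
        exact ⟨Q ∩ range K₀, Finset.mem_powerset.2 Finset.inter_subset_right, Finset.mem_filter.2 ⟨hQ, rfl⟩⟩
      · rintro ⟨Q', _, hQ⟩; exact (Finset.mem_filter.1 hQ).1
    · intro Q₁ _ Q₂ _ hne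
      rw [Function.onFun, Finset.disjoint_filter]
      intro Q _ h1 h2
      exact hne (h1.symm.trans h2)
  rw [hgroup]
  refine Finset.sum_le_sum fun Q' hQ' => ?_
  have hQ'sub : Q' ⊆ range K₀ := Finset.mem_powerset.1 hQ'
  by_cases hc : (wit j Q').Nonempty ∧ z₀ Q' = k
  · rw [if_pos hc, ← sum_hairW_inter_eq h hQ'sub K hK₀]
    refine Finset.sum_le_sum fun Q hQ => ?_
    have hQQ' : Q ∩ range K₀ = Q' := (Finset.mem_filter.1 hQ).2
    have hsel : prefixSel K₀ j z₀ Q = k := by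
      unfold prefixSel; rw [hQQ', if_pos hc.1]; exact hc.2
    have hne : (wit j Q).Nonempty := by
      obtain ⟨d, hd⟩ := hc.1
      exact ⟨d, wit_inter_range_subset j K₀ Q (hQQ' ▸ hd : d ∈ wit j (Q ∩ range K₀))⟩
    rw [if_pos ⟨hne, hsel⟩]
  · rw [if_neg hc]
    exact Finset.sum_nonneg fun Q _ => by split_ifs; exacts [hairW_nonneg hh Q, le_rfl]

/-! ## The least reliable witness dominates the average -/

/-- A least reliable witness (a member of `wit j Q` minimising `h`; junk `0` if there is none). [this work] -/
def minSel (h : ℕ → ℝ) (j : ℕ) (Q : Finset ℕ) : ℕ :=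
  if hQ : (wit j Q).Nonempty then Classical.choose (Finset.exists_min_image (wit j Q) h hQ) else 0

/-- The minimal-weight selection lies in the witness set. [this work] -/
theorem minSel_mem {h : ℕ → ℝ} {j : ℕ} {Q : Finset ℕ} (hQ : (wit j Q).Nonempty) : minSel h j Q ∈ wit j Q := by
  unfold minSel; rw [dif_pos hQ]
  exact (Classical.choose_spec (Finset.exists_min_image (wit j Q) h hQ)).1

/-- The minimal-weight selection has the least weight among the witnesses. [this work] -/
theorem minSel_le {h : ℕ → ℝ} {j : ℕ} {Q : Finset ℕ} (hQ : (wit j Q).Nonempty) {k : ℕ} (hk : k ∈ wit j Q) :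
    h (minSel h j Q) ≤ h k := by
  unfold minSel; rw [dif_pos hQ]
  exact (Classical.choose_spec (Finset.exists_min_image (wit j Q) h hQ)).2 k hk

/-- `minSel` is a valid selection. [this work] -/
theorem minSel_valid (h : ℕ → ℝ) (j : ℕ) : ∀ Q, Q ⊆ range K → (wit j Q).Nonempty → minSel h j Q ∈ wit j Q :=
  fun _ _ hQ => minSel_mem hQ

/-- **`witG` of the least reliable witness dominates `witGavg`** (`0 < h k ≤ 1` for `k < K`). [this work] -/
theorem witG_minSel_ge_witGavg {h : ℕ → ℝ} (hh : ∀ k, k < K → 0 < h k ∧ h k ≤ 1) (j : ℕ) :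
    witGavg K h j ≤ witG K h j (minSel h j) := by
  unfold witGavg witGW witMassW witG witMass
  -- both sides as sums over patterns
  rw [show (∑ k ∈ range K, (∑ Q ∈ (range K).powerset, hairW K h Q * witAvgKernel j Q k) / h k) =
      ∑ Q ∈ (range K).powerset, ∑ k ∈ range K, hairW K h Q * witAvgKernel j Q k / h k by
    rw [Finset.sum_comm]; refine Finset.sum_congr rfl fun k _ => by rw [Finset.sum_div]]
  rw [show (∑ k ∈ range K, (∑ Q ∈ (range K).powerset, if (wit j Q).Nonempty ∧ minSel h j Q = k then hairW K h Q else 0) / h k) =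
      ∑ Q ∈ (range K).powerset, ∑ k ∈ range K, (if (wit j Q).Nonempty ∧ minSel h j Q = k then hairW K h Q else 0) / h k by
    rw [Finset.sum_comm]; refine Finset.sum_congr rfl fun k _ => by rw [Finset.sum_div]]
  refine Finset.sum_le_sum fun Q hQ => ?_
  have hQsub : Q ⊆ range K := Finset.mem_powerset.1 hQ
  have hWn : 0 ≤ hairW K h Q := hairW_nonneg (fun k hk => ⟨(hh k hk).1.le, (hh k hk).2⟩) Q
  by_cases hne : (wit j Q).Nonempty
  · -- right side: the single term `k = minSel`
    have hmem : minSel h j Q ∈ range K := hQsub (mem_of_mem_wit (minSel_mem hne))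
    have hmpos : 0 < h (minSel h j Q) := (hh _ (Finset.mem_range.1 hmem)).1
    have hr : ∑ k ∈ range K, (if (wit j Q).Nonempty ∧ minSel h j Q = k then hairW K h Q else 0) / h k =
        hairW K h Q / h (minSel h j Q) := by
      rw [Finset.sum_eq_single_of_mem (minSel h j Q) hmem (fun k _ hk => by rw [if_neg (fun hc => hk hc.2.symm), zero_div]),
        if_pos ⟨hne, rfl⟩]
    rw [hr]
    -- left side: average of `hairW/h k` over the witnesses ≤ `hairW / h(minSel)`
    have hker : ∀ k ∈ range K, hairW K h Q * witAvgKernel j Q k / h k ≤ hairW K h Q * witAvgKernel j Q k / h (minSel h j Q) := by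
      intro k hk
      unfold witAvgKernel
      by_cases hkw : k ∈ wit j Q
      · rw [if_pos hkw]
        exact div_le_div_of_nonneg_left (mul_nonneg hWn (by positivity)) hmpos (minSel_le hne hkw)
      · rw [if_neg hkw, mul_zero, zero_div, zero_div]
    refine le_trans (Finset.sum_le_sum hker) ?_
    rw [← Finset.sum_div, ← Finset.mul_sum]
    have hsum : ∑ k ∈ range K, witAvgKernel j Q k ≤ 1 := by
      have h1 : ∑ k ∈ range K, witAvgKernel j Q k = ∑ k ∈ wit j Q, witAvgKernel j Q k := by
        symm
        refine Finset.sum_subset (fun d hd => hQsub (mem_of_mem_wit hd)) fun k _ hk => ?_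
        unfold witAvgKernel; rw [if_neg hk]
      rw [h1]
      exact (isWitKernel_witAvgKernel K j).2.2 Q hQsub
    exact div_le_div_of_nonneg_right (mul_le_of_le_one_right hWn hsum) hmpos.le
  · -- no witness: both sides vanish
    have hl : ∀ k ∈ range K, hairW K h Q * witAvgKernel j Q k / h k = 0 := fun k _ => by
      unfold witAvgKernel; rw [if_neg (fun hk => hne ⟨k, hk⟩), mul_zero, zero_div]
    have hr : ∀ k ∈ range K, (if (wit j Q).Nonempty ∧ minSel h j Q = k then hairW K h Q else 0) / h k = 0 := fun k _ => by
      rw [if_neg (fun hc => hne hc.1), zero_div]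
    rw [Finset.sum_congr rfl hl, Finset.sum_congr rfl hr]

/-- **PREFIX BOX ⇒ universal-witness weight ≥ 1.**  If `1 ≤ witGavg K₀ h j` then for every `K ≥ K₀` (with `0 < h ≤ 1` on `range K`)
the valid selection `prefixSel K₀ j (minSel h j)` has `1 ≤ witG K h j (prefixSel K₀ j (minSel h j))`. [this work] -/
theorem witG_prefix_ge_one {h : ℕ → ℝ} (hh : ∀ k, k < K → 0 < h k ∧ h k ≤ 1) {K₀ j : ℕ} (hK₀ : K₀ ≤ K)
    (hG : 1 ≤ witGavg K₀ h j) : 1 ≤ witG K h j (prefixSel K₀ j (minSel h j)) := by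
  have hh₀ : ∀ k, k < K₀ → 0 < h k ∧ h k ≤ 1 := fun k hk => hh k (lt_of_lt_of_le hk hK₀)
  have hh' : ∀ k, k < K → 0 ≤ h k ∧ h k ≤ 1 := fun k hk => ⟨(hh k hk).1.le, (hh k hk).2⟩
  exact hG.trans ((witG_minSel_ge_witGavg hh₀ j).trans (witG_prefix_ge hh' hK₀ _))

end Summit.CriticalPhenomena.PercolationContinuityZ3.Theorems.HairyCycle

end
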